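import Summits.CriticalPhenomena.PercolationContinuityZ3.Theorems.PercNearOneGluingNoHeavyLowerTailSahiCombSubstitution
import Summits.CriticalPhenomena.PercolationContinuityZ3.Theorems.PercNearOneGluingNoHeavyLowerTailSahiC3CombCubeFour

/-!
# `NoHeavyLowerTail` (crux stmt-CriticalPhenomena-4575), block substitution with FOUR blocks — COMPUTATIONAL companion of
# `…SahiCombSubstitution` (uses the `native_decide` certificate `SahiC3Cube.checkCube_four` through `…SahiC3CombCubeFour`)

Support file (cell `prim-l12`, seat P3, gen 2; `--supports stmt-CriticalPhenomena-4575`; proposed `--computational`).  No `sorry`.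

* **`combPos_sahiE_three_subst_le_four`** — monotone Boolean combinations of at most FOUR increasing events with pairwise disjoint supports
  satisfy (M⁺-3) in every dimension (patterns certified on the `4`-cube by `SahiC3CombCube.combPos_sahiE_three_of_card_le_four`);
  law-level and three-partition corollaries.
-/

noncomputable section

open scoped Classical

namespace Summit.CriticalPhenomena.PercolationContinuityZ3.Theorems

namespace SahiCombSubstitution

open Finset Function
open Literature.Combinatorics.Sahi2008
open Literature.Probability.Percolation (DeterminedBy)
open Literature.Probability.Percolation.DecisionTree (ind)
open SahiComb

variable {ι : Type} [Fintype ι] {r : ℕ}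

/-- **Block substitution, at most four blocks** (computational certificate). [this work] -/
theorem combPos_sahiE_three_subst_le_four (hr : r ≤ 4) (X : Fin r → Set (Set ι)) (S : Fin r → Finset ι)
    (hS : (Set.univ : Set (Fin r)).PairwiseDisjoint S) (hXd : ∀ j, DeterminedBy (X j) (↑(S j) : Set ι))
    (Φ : Fin 3 → Set (Set (Fin r))) (hΦ : ∀ i, IsUpperSet (Φ i)) :
    CombPos (fun _ : ι => 3) (fun p => sahiE (bernoulliWeight p) 3 (fun i => ind (subst X (Φ i)))) :=
  combPos_sahiE_three_subst X S hS hXd Φ ((ThreePartition.combPos_vec_iff Φ).2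
    (SahiC3CombCube.combPos_sahiE_three_of_card_le_four (by simpa using hr) (hΦ 0) (hΦ 1) (hΦ 2)))

/-- Law level: `E₃(μ_p) ≥ 0` for monotone combinations of at most four independent increasing block events. [this work] -/
theorem sahiE_three_subst_nonneg_le_four (p : ι → unitInterval) (hr : r ≤ 4) (X : Fin r → Set (Set ι)) (S : Fin r → Finset ι)
    (hS : (Set.univ : Set (Fin r)).PairwiseDisjoint S) (hXd : ∀ j, DeterminedBy (X j) (↑(S j) : Set ι))
    (Φ : Fin 3 → Set (Set (Fin r))) (hΦ : ∀ i, IsUpperSet (Φ i)) :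
    0 ≤ sahiE (bernoulliWeight p) 3 (fun i => ind (subst X (Φ i))) :=
  (combPos_sahiE_three_subst_le_four hr X S hS hXd Φ hΦ).nonneg p

/-- (★★) for substituted triples with at most four blocks: `threePartNT τ ≥ 0`, every twist. [this work] -/
theorem threePartNT_subst_nonneg_le_four (τ : Set ι) (hr : r ≤ 4) (X : Fin r → Set (Set ι)) (S : Fin r → Finset ι)
    (hS : (Set.univ : Set (Fin r)).PairwiseDisjoint S) (hXd : ∀ j, DeterminedBy (X j) (↑(S j) : Set ι))
    (Φ : Fin 3 → Set (Set (Fin r))) (hΦ : ∀ i, IsUpperSet (Φ i)) :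
    0 ≤ ThreePartition.threePartNT τ (subst X (Φ 0)) (subst X (Φ 1)) (subst X (Φ 2)) :=
  ThreePartition.threePartNT_nonneg_of_combPos τ ((ThreePartition.combPos_vec_iff (fun i => subst X (Φ i))).1
    (combPos_sahiE_three_subst_le_four hr X S hS hXd Φ hΦ))

end SahiCombSubstitution

end Summit.CriticalPhenomena.PercolationContinuityZ3.Theorems
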